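import Literature.Analysis.FluidPDE.NSLerayHopfSereginMild
import Literature.Analysis.FluidPDE.KatoMaximalTimeSingular
import Literature.Analysis.FluidPDE.NSKatoToClayHolds
import Literature.Analysis.FluidPDE.NSWeakStrongUniquenessHolds
import Literature.Analysis.FluidPDE.KatoLocalHolds
import HarnessLib

/-!
# Seregin's `L³` blow-up criterion for energy solutions (Seregin 2012, Thm. 1.1 as printed):
# reduction of `seregin_L3_blowup_energy` to the two leaves of `seregin_L3_blowup_mild`

Analysis/FluidPDE proofs file (no definitions, no named facts) over
`NSLerayHopfSereginProofs.lean`, which vendors Seregin's theorem verbatim as the named fact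
`Literature.Analysis.FluidPDE.seregin_L3_blowup_energy` (Seregin, Comm. Math. Phys. 312 (2012)
833–845 = arXiv:1104.3615, Thm. 1.1, p. 2): for an *energy solution* `v` (global Leray–Hopf weak
solution obeying the energy inequality (1.4)) of the Cauchy problem with datum
`a ∈ C^∞_{0,0}(ℝ³)` ((1.3): smooth, compactly supported, divergence free) and a finite *blow-up
time* `T` — "the first instant of time when singularities occur", a point `z₀ = (x₀, t₀)` being
regular iff `v` is essentially bounded on some parabolic ball `Q(z₀, r)` — one has
`‖v(·, t)‖₃ → ∞` as `t ↑ T`.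

The printed proof (§2, p. 3: "By the definition of a blow up time for energy solutions, there
exists at least one singular point at time `T` … assume `sup_k ‖v(·,t_k)‖₃ = M < ∞`"; §§2–4:
rescaling about the singular point, the split `u^{(k)} = v^{(k)} + w^{(k)}`, local energy
solutions, backward uniqueness) is, word for word, the argument the tree has already isolated —
for Kato's mild `C_t L³` solutions — as the named fact `seregin_regular_of_liminf_L3`
(`NSLerayHopfSereginMild.lean`; Lemarié-Rieusset 2016, proof of Thm. 15.5, PDF pp. 570–573),
next to `lemarieRieusset_singular_point_of_blowup` (Lemarié-Rieusset 2016, Thm. 15.1 (C): a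
finite maximal time of the mild solution carries a singular point); these are the two leaves from
which `seregin_L3_blowup_mild` (Lemarié-Rieusset's Thm. 15.5) is proved
(`seregin_L3_blowup_mild_of_singular_point`). This file **proves Seregin's energy-solution
statement from the same two leaves** (`seregin_L3_blowup_energy_of_leaves`); what it adds is the
passage from the energy solution `v` to the Kato solution of its datum, i.e. the classical facts
quoted in Seregin's introduction ("This solution is smooth and unique for sufficiently small
values of `t`") in the global form needed here:

* `exists_isTaoSolutionOn_of_isKatoSolutionOn` — **`C([0,T); L³)` is a regularity class, local
  form** (von Wahl 1985; Lemarié-Rieusset 2016, Prop. 12.3, 4th item, with Thm. 7.2 and Thm. 7.7;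
  Kato 1984, Thm. 4): for `ν > 0`, a smooth, divergence-free, rapidly decaying datum `u₀` and a
  Kato solution `w` on `[0, T')`, there is for every `0 < Tt < T'` a Tao-class classical solution
  `(u, p)` from `u₀` on the closed slab `[0, Tt] × ℝ³` (`IsTaoSolutionOn`). PROVED: the restart
  induction of `exists_isTaoSolutionOn_of_hasGlobalKatoSolution'` (`NSKatoToClayHolds.lean`,
  which assumed a *global* Kato solution) run below `T'` — the Fourier–Picard restart piece
  (`exists_isTaoSolutionOn_fourierPiece`) has a lifespan controlled, without any `L^∞` bound, by
  the energy and the `L²_t H²_x` dissipation, which the enstrophy inequality under the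
  `L³`-small plus bounded splitting along `w` (`IsTaoSolutionOn.lintegral_laplacian_sq_le_of_tails`)
  bounds in terms of `u₀` on `[0, (Tt + T')/2]`.
* `IsGlobalLerayHopf.ae_eq_of_isKatoSolutionOn` — **weak = strong**: an energy solution `v` from
  `a ∈ C_c^∞` divergence free agrees at every time `t ∈ (0, T')` a.e. with any Kato solution `w`
  on `[0, T')` (Prodi 1959 / Serrin 1963, Thm. 6, the proved `weak_strong_uniqueness_holds`,
  applied to the Tao-class solution on `[0, S]`, `t < S < T'`, which is Leray–Hopf
  (`IsTaoSolutionOn.isLerayHopfOn`, Tao 2011, Lemma 8.1) and bounded, hence in Serrin's class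
  `L^∞_t L^∞_x`; and Furioli–Lemarié-Rieusset–Terraneo 2000, Thm. 1 = `kato_unique_holds`,
  through `IsTaoSolutionOn.ae_eq_of_kato`, to identify the Tao-class solution with `w`).
* `seregin_L3_blowup_energy_of_leaves :
    lemarieRieusset_singular_point_of_blowup → seregin_regular_of_liminf_L3 →
    seregin_L3_blowup_energy` — the assembly. With `T_max = katoMaximalTime ν a > 0`
  (`katoMaximalTime_pos`, `kato_local_holds`): (i) `T ≤ T_max`, for otherwise the maximal Kato
  solution on `[0, T_max)` (`exists_isKatoSolutionOn_katoMaximalTime`, `kato_unique_holds`) has a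
  singular point `(T_max, x₁)` (Thm. 15.1 (C)), which by the agreement is a singular point of `v`
  (`eLpNorm_parabolicCylinder_eq_top_of_ae_eq`) at a time `T_max ∈ (0, T)` — excluded by the
  definition of the blow-up time; (ii) so the Kato solution `u` of `a` lives on `[0, T)` and
  `‖v(t)‖₃ = ‖u(t)‖₃` for `0 < t < T`; if `‖v(t)‖₃ ↛ ∞` then `liminf_{t↑T} ‖u(t)‖₃ < ∞`, every
  `(T, x₀)` is regular for `u` (`seregin_regular_of_liminf_L3`), hence for `v` — contradicting the
  singular point `(T, x₀)` of the blow-up time. This is Seregin's §2, first paragraph, with the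
  identification `v = u` made explicit.

Consequently `seregin_L3_blowup_energy_holds` will follow from the discharges of
`lemarieRieusset_singular_point_of_blowup` and `seregin_regular_of_liminf_L3` (the DAG below them
is `NSLerayHopfSereginLeaves.lean` / `NSSereginMild*.lean`); nothing accepted is restated, no new
named fact is introduced.

## Transcription notes

* The datum `a ∈ C^∞_{0,0}` of `seregin_L3_blowup_energy` is in particular rapidly decaying
  (`HasRapidSpatialDecay.of_hasCompactSupport`), in `L² ∩ L³`
  (`Continuous.memLp_of_hasCompactSupport`) and weakly divergence free
  (`VectorCalculus.IsDivFree.isWeaklyDivFree_holds`); `NSWave0.IsDivFree` and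
  `VectorCalculus.IsDivFree` are the same predicate.
* Singular/regular points are in the backward essential-`L^∞` form of the fact
  (`parabolicCylinder r (t₀, x₀) = (t₀ - r², t₀) × B(x₀, r)`), which only sees times `< t₀`;
  a.e. agreement on the strip `(0, t₀) × ℝ³` therefore transfers them
  (`eLpNorm_parabolicCylinder_eq_top_of_ae_eq`, `RusinSverakLeraySolutions.lean`), and slice-wise
  agreement is upgraded to the strip by Fubini (`ae_restrict_prod_of_forall_ae_eq`,
  `KatoMaximalTimeSingular.lean`).

## References

* G. Seregin, *A certain necessary condition of potential blow up for Navier–Stokes equations*,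
  Comm. Math. Phys. 312 (2012) 833–845 = arXiv:1104.3615: Thm. 1.1 and the definitions of
  regular point / blow-up time (p. 2), §2 first paragraph and (2.1)–(2.2) (p. 3).
* P. G. Lemarié-Rieusset, *The Navier–Stokes Problem in the 21st Century*, CRC Press (2016),
  doi:10.1201/b19556: Thm. 15.1 (C) (PDF pp. 565–566), Thm. 15.5 and its proof (pp. 570–573),
  Prop. 12.3 (p. 393), Thm. 7.2 (p. 147), Thm. 7.7 (p. 169).
* W. von Wahl, *The Equations of Navier–Stokes and Abstract Parabolic Equations*, Vieweg (1985)
  (regularity of `C([0,T]; L³)` solutions, as cited in Lemarié-Rieusset 2016, Prop. 12.3).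
* T. Kato, Math. Z. 187 (1984) 471–480, Thms. 1, 4. G. Furioli, P. G. Lemarié-Rieusset,
  E. Terraneo, Rev. Mat. Iberoam. 16 (2000), Thm. 1.
* G. Prodi, Ann. Mat. Pura Appl. 48 (1959); J. Serrin, in *Nonlinear Problems* (1963), Thm. 6
  (weak–strong uniqueness). T. Tao, *Localisation and compactness properties of the Navier–Stokes
  global regularity problem*, Anal. PDE 6 (2013) = arXiv:1108.1165, Lemma 8.1.
-/

noncomputable section

open MeasureTheory Set Function Filter Topology Real Complex FourierTransform InnerProductSpace
open scoped ENNReal NNReal ContDiff FourierTransform ComplexConjugate Laplacian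

namespace Literature.Analysis.FluidPDE

open FourierNS

/-! ### The datum: compactly supported smooth fields decay rapidly -/

/-- A smooth compactly supported field is rapidly decaying in Fefferman's sense
(`HasRapidSpatialDecay`: `(1 + |x|)^K |Dⁿu₀(x)| ≤ C_{n,K}`): each `Dⁿu₀` is continuous with
compact support, so `(1 + |x|)^K |Dⁿu₀(x)|` is a continuous compactly supported, hence bounded,
function. [folklore] -/
theorem HasRapidSpatialDecay.of_hasCompactSupport
    {u₀ : EuclideanSpace ℝ (Fin 3) → EuclideanSpace ℝ (Fin 3)} (hsm : ContDiff ℝ ∞ u₀)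
    (hc : HasCompactSupport u₀) : HasRapidSpatialDecay u₀ := by
  intro n K
  have hcont : Continuous fun x => (1 + ‖x‖) ^ K * ‖iteratedFDeriv ℝ n u₀ x‖ :=
    ((continuous_const.add continuous_norm).pow K).mul
      (hsm.continuous_iteratedFDeriv (m := n) (mod_cast le_top)).norm
  have hsupp : HasCompactSupport fun x => (1 + ‖x‖) ^ K * ‖iteratedFDeriv ℝ n u₀ x‖ :=
    ((hc.iteratedFDeriv n).norm).mul_left
  obtain ⟨C, hC⟩ := hcont.bounded_above_of_compact_support hsupp
  refine ⟨C, fun x => ?_⟩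
  have h := hC x
  rwa [Real.norm_eq_abs, abs_of_nonneg (by positivity)] at h

/-! ### `C([0,T); L³)` is a regularity class — local form along a Kato solution -/

/-- **`C([0, T); L³)` is a regularity class, local form** (von Wahl 1985; Lemarié-Rieusset 2016,
Prop. 12.3, 4th item, with Thm. 7.2 and Thm. 7.7; Kato 1984, Thm. 4). For `ν > 0`, a smooth,
divergence-free, rapidly decaying datum `u₀`, a Kato solution `w` on `[0, T')`
(`IsKatoSolutionOn`: mild in duality form, `C([0,T'); L³)`, `w 0 = u₀`, measurable) and every
`0 < Tt < T'`, there is a Tao-class solution from `u₀` on the closed slab `[0, Tt] × ℝ³`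
(`IsTaoSolutionOn`: classical, jointly smooth up to `t = 0`, all `L²` Sobolev norms of `u`,
`∂ₜu`, `p` bounded, `u ∈ C([0,Tt]; L²)`). The proof is the restart induction of
`exists_isTaoSolutionOn_of_hasGlobalKatoSolution'` (`NSKatoToClayHolds.lean`) verbatim, run on
`[0, Tw]` with `Tw = (Tt + T')/2 < T'` in place of `Tt + 1`: along the induction the Tao-class
solution on `[0, F]`, `F ≤ Tw`, agrees a.e. with `w` (`IsTaoSolutionOn.ae_eq_of_kato_Icc`, by
`kato_unique_holds`), whose `L³` tails are uniformly small on the compact `[0, Tw]`, so the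
enstrophy inequality under splitting bounds the energy and the `L²_t H²_x` dissipation in terms
of `u₀` (`IsTaoSolutionOn.lintegral_laplacian_sq_le_of_tails`), Plancherel transports the bounds
to the Fourier side (`IsFourierMild.dissip_le_of_synthVel`), Leray's doubling argument
(`FourierNS.exists_window_of_energy_dissip`) bounds the order-`4` Fourier weights, and the
Fourier–Picard restart piece (`exists_isTaoSolutionOn_fourierPiece`) has a uniform lifespan;
finitely many restarts glued by `IsTaoSolutionOn.glue` / `IsFourierMild.glue` cover `[0, Tt]`.
[cite: LemarieRieusset2016, Prop. 12.3 (von Wahl) with Thm. 7.2 and Thm. 7.7, PDF pp. 147, 169, 393] -/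
theorem exists_isTaoSolutionOn_of_isKatoSolutionOn {ν : ℝ} (hν : 0 < ν)
    {u₀ : EuclideanSpace ℝ (Fin 3) → EuclideanSpace ℝ (Fin 3)} (hsm : ContDiff ℝ ∞ u₀)
    (hdiv : NSWave0.IsDivFree u₀) (hdec : HasRapidSpatialDecay u₀) {T' : ℝ}
    {w : ℝ → EuclideanSpace ℝ (Fin 3) → EuclideanSpace ℝ (Fin 3)} (hw : IsKatoSolutionOn T' ν u₀ w)
    {Tt : ℝ} (hTt : 0 < Tt) (hTtT' : Tt < T') :
    ∃ (u : ℝ → EuclideanSpace ℝ (Fin 3) → EuclideanSpace ℝ (Fin 3))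
      (p : ℝ → EuclideanSpace ℝ (Fin 3) → ℝ), IsTaoSolutionOn Tt ν u₀ u p := by
  set Tw : ℝ := (Tt + T') / 2 with hTw
  have hTtw : Tt < Tw := by rw [hTw]; linarith
  have hTwT' : Tw < T' := by rw [hTw]; linarith
  have hTw0 : 0 < Tw := hTt.trans hTtw
  /- the Kato solution on the closed sub-slabs `[0, F]`, `F ≤ Tw < T'` -/
  have hwmild : ∀ F : ℝ, F ≤ Tw → IsMildNSSolutionOn (Ico 0 F) ν 0 u₀ w := fun F hF =>
    hw.mild.mono (Ico_subset_Ico_right (hF.trans hTwT'.le))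
  have hwc : ∀ F : ℝ, F ≤ Tw → ContinuousInLpOn (Icc 0 F) 3 w := fun F hF =>
    hw.continuousInLpOn.mono fun t ht => ⟨ht.1, lt_of_le_of_lt (ht.2.trans hF) hTwT'⟩
  have hwm : ∀ F : ℝ, F ≤ Tw →
      AEStronglyMeasurable (uncurry w) (volume.restrict (Ioo 0 F ×ˢ univ)) := fun F hF =>
    hw.aestronglyMeasurable.mono_measure (Measure.restrict_mono
      (Set.prod_mono (Ioo_subset_Ioo_right (hF.trans hTwT'.le)) Subset.rfl) le_rfl)
  /- the splitting threshold `8 (δK)² ≤ ν²` and the `L³` tails of `w` on `[0, Tw]` -/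
  set Ks : ℝ := (SNormLESNormFDerivOfEqConst (EuclideanSpace ℝ (Fin 3))
    (volume : Measure (EuclideanSpace ℝ (Fin 3))) 2 : ℝ) with hKs
  have hKs0 : 0 ≤ Ks := NNReal.coe_nonneg _
  set δ : ℝ := ν / (4 * (Ks + 1)) with hδdef
  have hδ0 : 0 < δ := by positivity
  have hδK : δ * Ks ≤ ν / 4 := by
    rw [hδdef, div_mul_eq_mul_div, div_le_div_iff₀ (by positivity) (by positivity)]
    nlinarith [hν]
  have hδ8 : 8 * (δ * Ks) ^ 2 ≤ ν ^ 2 := by nlinarith [hδK, mul_nonneg hδ0.le hKs0]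
  have hδ2 : 2 * (δ * Ks) ^ 2 ≤ ν ^ 2 := by nlinarith [hδ8, sq_nonneg (δ * Ks)]
  obtain ⟨lam, hlam⟩ := (hwc Tw le_rfl).exists_forall_eLpNorm_indicator_le
    isCompact_Icc (by norm_num : (1 : ℝ≥0∞) ≤ 3) (by norm_num) hδ0
  set M : ℝ := max (lam : ℝ) 1 with hM
  have hMpos : 0 < M := lt_of_lt_of_le one_pos (le_max_right _ _)
  /- energy and enstrophy of the datum -/
  set e₀ : ℝ := 2 * VectorCalculus.kineticEnergy u₀ with he₀
  have he₀0 : 0 ≤ e₀ := mul_nonneg zero_le_two (kineticEnergy_nonneg _)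
  have hHinf : ∀ n : ℕ, ∫⁻ x, ‖iteratedFDeriv ℝ n u₀ x‖ₑ ^ 2 < ⊤ :=
    hdec.lintegral_enorm_iteratedFDeriv_sq_lt_top
  have hG₀ : ∫⁻ x, ENNReal.ofReal (frobeniusNormSq (fderiv ℝ u₀ x)) < ⊤ := by
    calc ∫⁻ x, ENNReal.ofReal (frobeniusNormSq (fderiv ℝ u₀ x))
        ≤ ∫⁻ x, 3 * ‖iteratedFDeriv ℝ 1 u₀ x‖ₑ ^ 2 := lintegral_mono fun x => by
          rw [← ofReal_norm, norm_iteratedFDeriv_one, ofReal_norm]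
          exact ofReal_frobeniusNormSq_le_three_mul_enorm_sq _
      _ = 3 * ∫⁻ x, ‖iteratedFDeriv ℝ 1 u₀ x‖ₑ ^ 2 := lintegral_const_mul' _ _ (by simp)
      _ < ⊤ := ENNReal.mul_lt_top (by simp) (hHinf 1)
  set g₀ : ℝ := (∫⁻ x, ENNReal.ofReal (frobeniusNormSq (fderiv ℝ u₀ x))).toReal with hg₀
  have hg₀0 : 0 ≤ g₀ := ENNReal.toReal_nonneg
  have hg₀eq : ∫⁻ x, ENNReal.ofReal (frobeniusNormSq (fderiv ℝ u₀ x)) = ENNReal.ofReal g₀ := by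
    rw [hg₀, ENNReal.ofReal_toReal hG₀.ne]
  /- the dissipation budget -/
  set κw : ℝ := ν⁻¹ * (1 + 4 * M ^ 2 * Tw / ν * Real.exp (2 * M ^ 2 * Tw / ν)) with hκw
  have hκw0 : 0 ≤ κw := by positivity
  set D : ℝ := ((2 * π) ^ 4)⁻¹ * (κw * g₀) with hD
  have hD0 : 0 ≤ D := by positivity
  /- the heat rate, the order, the window, the initial Fourier datum -/
  set cF : ℝ := 4 * π ^ 2 * ν with hcF
  have hcF0 : 0 < cF := by positivity
  have hι : Fintype.card (Fin 3) < 4 := by simp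
  obtain ⟨τw, hτw, hwindow⟩ := exists_window_of_energy_dissip (ι := Fin 3) hι hcF0
    (Fintype.card (Fin 3) + 1) he₀0 hD0
  set a₀ : EuclideanSpace ℝ (Fin 3) → Fin 3 → ℂ := fourierData hsm hdec with ha₀
  obtain ⟨A₀, hA₀⟩ := hasDecay_fourierData hsm hdec (Fintype.card (Fin 3) + 1)
  have hA₀0 : 0 ≤ A₀ := hA₀.nonneg
  set Aunif : ℝ := 2 ^ ⌈Tw / τw⌉₊ * A₀ with hAunif
  have hAunif0 : 0 ≤ Aunif := by positivity
  set TP : ℝ := picardTime (Fin 3) cF (Fintype.card (Fin 3) + 1) (2 * Aunif) with hTP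
  have hTPpos : 0 < TP := picardTime_pos hcF0 _ _ (by positivity)
  have hdiv' : ∀ ξ : EuclideanSpace ℝ (Fin 3), ∑ l, (ξ l : ℂ) * a₀ ξ l = 0 :=
    sum_mul_fourierData hsm hdec hdiv
  have hconj₀ : ∀ ξ l, a₀ (-ξ) l = conj (a₀ ξ l) := fourierData_conj_symm hsm hdec
  have hsynth₀ : synthVel a₀ = u₀ := by
    funext x
    ext l
    rw [synthVel_apply, show (fun ξ => a₀ ξ l) = fun ξ => fourierData hsm hdec ξ l from rfl,
      fourier_fourierData hsm hdec l]
    simp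
  /- the state of the induction -/
  set State : ℝ → (ℝ → EuclideanSpace ℝ (Fin 3) → EuclideanSpace ℝ (Fin 3)) →
      (ℝ → EuclideanSpace ℝ (Fin 3) → ℝ) → (ℝ → EuclideanSpace ℝ (Fin 3) → Fin 3 → ℂ) → Prop :=
    fun F u p V => IsTaoSolutionOn F ν u₀ u p ∧
      IsFourierMild cF (Fintype.card (Fin 3) + 1) 0 F V ∧
      (∀ t ∈ Icc 0 F, u t = synthVel (V t)) ∧ V 0 = a₀ with hState
  /- uniform bounds for a state on `[0, F]`, `F ≤ Tw`: energy, dissipation, weights -/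
  have hbounds : ∀ ⦃F : ℝ⦄ ⦃u : ℝ → EuclideanSpace ℝ (Fin 3) → EuclideanSpace ℝ (Fin 3)⦄
      ⦃p : ℝ → EuclideanSpace ℝ (Fin 3) → ℝ⦄ ⦃V : ℝ → EuclideanSpace ℝ (Fin 3) → Fin 3 → ℂ⦄,
      0 < F → F ≤ Tw → State F u p V →
        ∀ t' ∈ Icc 0 F, HasDecay (Fintype.card (Fin 3) + 1) Aunif (V t') := by
    intro F u p V hF hFw hS t' ht'
    obtain ⟨h, hV, hsyn, hV0⟩ := hS
    -- identification with the Kato solution and the `L³` tails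
    have hae : ∀ s ∈ Icc 0 F, u s =ᵐ[volume] w s :=
      h.ae_eq_of_kato_Icc hν hF (hwmild F hFw) (hwc F hFw) (hwm F hFw)
    have htail : ∀ s ∈ Icc 0 F,
        eLpNorm ({x | lam ≤ ‖w s x‖₊}.indicator (w s)) 3 volume ≤ ENNReal.ofReal δ :=
      fun s hs => hlam s ⟨hs.1, hs.2.trans hFw⟩
    -- energy of the Fourier side
    have hE : ∀ r ∈ Icc 0 F, ∫⁻ η, ‖V r η‖ₑ ^ 2 ≤ ENNReal.ofReal e₀ := by
      intro r hr
      have hdecr : ∀ K : ℕ, ∃ B, HasDecay K B (V r) := fun K => by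
        obtain ⟨B, hB⟩ := hV.decay K
        exact ⟨B, hB r⟩
      calc ∫⁻ η, ‖V r η‖ₑ ^ 2 ≤ ∫⁻ x, ‖synthVel (V r) x‖ₑ ^ 2 :=
            lintegral_enorm_sq_le_of_synthVel (V r) (hV.continuous_slice r) hdecr
              (fun ξ l => hV.conjSymm r ξ l)
        _ = ∫⁻ x, ‖u r x‖ₑ ^ 2 := by rw [hsyn r hr]
        _ ≤ ENNReal.ofReal e₀ := h.lintegral_enorm_sq_le hF hν.le hr
    -- dissipation of the Fourier side
    have hDis : dissip V 0 F ≤ ENNReal.ofReal D := by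
      have h1 : ∀ r ∈ Icc 0 F, ∫⁻ x, ‖iteratedFDeriv ℝ 1 (u r) x‖ₑ ^ 2 < ⊤ := fun r hr =>
        (h.slice hr).2.2 1
      have h2 : ∀ r ∈ Icc 0 F, ∫⁻ x, ‖iteratedFDeriv ℝ 2 (u r) x‖ₑ ^ 2 < ⊤ := fun r hr =>
        (h.slice hr).2.2 2
      have h3 : ∀ r ∈ Icc 0 F, ∫⁻ x, ‖iteratedFDeriv ℝ 3 (u r) x‖ₑ ^ 2 < ⊤ := fun r hr =>
        (h.slice hr).2.2 3
      have hdis := hV.dissip_le_of_synthVel hsyn (fun r hr => (h.slice hr).1) h1 h2 h3 le_rfl le_rfl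
      have hlap := h.lintegral_laplacian_sq_le_of_tails hν hF hae hδ0.le hδ8 htail
      have hIoc : ∫⁻ r in Ioc 0 F, ∫⁻ x, ‖(Δ (u r)) x‖ₑ ^ 2 =
          ∫⁻ r in Ioo 0 F, ∫⁻ x, ‖(Δ (u r)) x‖ₑ ^ 2 := setLIntegral_congr Ioo_ae_eq_Ioc.symm
      have hκle : ν⁻¹ * (1 + 4 * M ^ 2 * F / ν * Real.exp (2 * M ^ 2 * F / ν)) ≤ κw := by
        rw [hκw]
        refine mul_le_mul_of_nonneg_left ?_ (by positivity)
        have hexp : Real.exp (2 * M ^ 2 * F / ν) ≤ Real.exp (2 * M ^ 2 * Tw / ν) :=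
          Real.exp_le_exp.2 (div_le_div_of_nonneg_right
            (mul_le_mul_of_nonneg_left hFw (by positivity)) hν.le)
        have h4 : 4 * M ^ 2 * F / ν ≤ 4 * M ^ 2 * Tw / ν :=
          div_le_div_of_nonneg_right (mul_le_mul_of_nonneg_left hFw (by positivity)) hν.le
        have h5 : 0 ≤ 4 * M ^ 2 * F / ν := by positivity
        nlinarith [mul_le_mul h4 hexp (Real.exp_nonneg _) (h5.trans h4), Real.exp_nonneg (2 * M ^ 2 * F / ν)]
      calc dissip V 0 F ≤ ENNReal.ofReal (((2 * π) ^ 4)⁻¹) *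
            ∫⁻ r in Ioc 0 F, ∫⁻ x, ‖(Δ (u r)) x‖ₑ ^ 2 := hdis
        _ ≤ ENNReal.ofReal (((2 * π) ^ 4)⁻¹) * (ENNReal.ofReal κw * ENNReal.ofReal g₀) := by
            rw [hIoc, ← hg₀eq]
            gcongr
            exact hlap.trans (mul_le_mul_of_nonneg_right (ENNReal.ofReal_le_ofReal hκle) bot_le)
        _ = ENNReal.ofReal D := by
            rw [hD, ← ENNReal.ofReal_mul hκw0, ← ENNReal.ofReal_mul (by positivity)]
    -- the doubling argument
    have hVA₀ : HasDecay (Fintype.card (Fin 3) + 1) A₀ (V 0) := by rw [hV0]; exact hA₀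
    have hdecay := hwindow hV hE hDis hVA₀ t' ht'
    rw [sub_zero] at hdecay
    refine hdecay.mono (mul_le_mul_of_nonneg_right ?_ hA₀0)
    exact pow_le_pow_right₀ one_le_two (Nat.ceil_le_ceil (div_le_div_of_nonneg_right hFw hτw.le))
  /- the restart step -/
  have hstep : ∀ ⦃F : ℝ⦄ ⦃u : ℝ → EuclideanSpace ℝ (Fin 3) → EuclideanSpace ℝ (Fin 3)⦄
      ⦃p : ℝ → EuclideanSpace ℝ (Fin 3) → ℝ⦄ ⦃V : ℝ → EuclideanSpace ℝ (Fin 3) → Fin 3 → ℂ⦄,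
      0 < F → F ≤ Tt → State F u p V →
      ∃ (F' : ℝ) (u' : ℝ → EuclideanSpace ℝ (Fin 3) → EuclideanSpace ℝ (Fin 3))
        (p' : ℝ → EuclideanSpace ℝ (Fin 3) → ℝ) (V' : ℝ → EuclideanSpace ℝ (Fin 3) → Fin 3 → ℂ),
        (Tw ≤ F' ∨ F + TP / 2 ≤ F') ∧ F' ≤ Tw ∧ 0 < F' ∧ State F' u' p' V' := by
    intro F u p V hF hFT hS
    have hFw : F ≤ Tw := hFT.trans hTtw.le
    have hdecay := hbounds hF hFw hS
    obtain ⟨h, hV, hsyn, hV0⟩ := hS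
    set t' : ℝ := max (F / 2) (F - TP / 4) with ht'
    have ht'0 : 0 ≤ t' := le_max_of_le_left (by linarith)
    have ht'F : t' < F := max_lt (by linarith) (by linarith)
    have hFt' : F ≤ t' + TP := by linarith [le_max_right (F / 2) (F - TP / 4)]
    have ht'I : t' ∈ Icc 0 F := ⟨ht'0, ht'F.le⟩
    -- the restart piece from the Fourier-side state `V t'`
    have hdecAll : ∀ K : ℕ, ∃ B, HasDecay K B (V t') := fun K => by
      obtain ⟨B, hB⟩ := hV.decay K
      exact ⟨B, hB t'⟩
    obtain ⟨v, q, W, hv, hW, hvsyn, hW0⟩ := exists_isTaoSolutionOn_fourierPiece hν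
      (hV.continuous_slice t') hdecAll (hdecay t' ht'I) (hV.divFree t') (hV.conjSymm t')
    rw [← hcF, ← hTP] at hv hW
    have hvt' : synthVel (V t') = u t' := (hsyn t' ht'I).symm
    rw [hvt'] at hv
    -- the physical glue
    have hglue := h.glue hv hν hTPpos ht'0 ht'F hFt'
    -- the agreement on the overlap
    have hagree : ∀ s ∈ Ico 0 (min (F - t') TP), u (s + t') = v s :=
      (h.translate ht'0 ht'F).eq_of_isTaoSolutionOn hv hν (by linarith) hTPpos
    -- the Fourier glue
    have hW' : IsFourierMild cF (Fintype.card (Fin 3) + 1) t' (t' + TP) (fun t => W (t - t')) := by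
      have := hW.translate t'
      simpa only [zero_add, add_comm TP t'] using this
    have hVt' : IsFourierMild cF (Fintype.card (Fin 3) + 1) 0 t' V := hV.mono le_rfl ht'0 ht'F.le
    have hjunction : V t' = (fun t => W (t - t')) t' := by simp only [sub_self, hW0]
    have hGlueF := hVt'.glue hW' hjunction
    set F' : ℝ := min (t' + TP) Tw with hF'
    have hF'pos : 0 < F' := lt_min (by linarith) hTw0
    have hF'le : F' ≤ t' + TP := min_le_left _ _
    refine ⟨F', (fun t => if t < F then u t else v (t - t')),
      (fun t => if t < F then p t else q (t - t')), (fun t => if t ≤ t' then V t else W (t - t')),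
      ?_, min_le_right _ _, hF'pos, ?_, ?_, ?_, ?_⟩
    · by_cases hcase : t' + TP ≤ Tw
      · right; rw [hF', min_eq_left hcase]; linarith [le_max_right (F / 2) (F - TP / 4)]
      · left; rw [hF', min_eq_right (le_of_not_ge hcase)]
    · exact hglue.mono hF'pos hF'le
    · exact hGlueF.mono le_rfl hF'pos.le hF'le
    · -- synthesis at every time of `[0, F']`
      intro t ht
      by_cases htt' : t ≤ t'
      · have htF : t < F := lt_of_le_of_lt htt' ht'F
        simp only [if_pos htF, if_pos htt']
        exact hsyn t ⟨ht.1, htF.le⟩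
      · have hgt : t' < t := not_le.1 htt'
        simp only [if_neg htt']
        by_cases htF : t < F
        · simp only [if_pos htF]
          have hs : t - t' ∈ Ico 0 (min (F - t') TP) :=
            ⟨by linarith, lt_min (by linarith) (by linarith [ht.2])⟩
          have := hagree (t - t') hs
          rw [sub_add_cancel] at this
          rw [this, hvsyn]
        · simp only [if_neg htF]
          exact hvsyn (t - t')
    · -- the initial Fourier datum is unchanged
      show (if (0 : ℝ) ≤ t' then V 0 else W (0 - t')) = a₀
      rw [if_pos ht'0, hV0]
  /- the first state, from the Schwartz datum -/
  have hbase : ∃ (F : ℝ) (u : ℝ → EuclideanSpace ℝ (Fin 3) → EuclideanSpace ℝ (Fin 3))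
      (p : ℝ → EuclideanSpace ℝ (Fin 3) → ℝ) (V : ℝ → EuclideanSpace ℝ (Fin 3) → Fin 3 → ℂ),
      0 < F ∧ F ≤ Tw ∧ State F u p V := by
    obtain ⟨u, p, V, hu, hV, hsyn, hV0⟩ := exists_isTaoSolutionOn_fourierPiece hν
      (continuous_fourierData hsm hdec) (hasDecay_fourierData hsm hdec) hA₀ hdiv' hconj₀
    rw [hsynth₀] at hu
    set T₀ : ℝ := picardTime (Fin 3) (4 * π ^ 2 * ν) (Fintype.card (Fin 3) + 1) (2 * A₀) with hT₀
    have hT₀pos : 0 < T₀ := picardTime_pos hcF0 _ _ (by positivity)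
    set F₀ : ℝ := min T₀ Tw with hF₀
    have hF₀pos : 0 < F₀ := lt_min hT₀pos hTw0
    refine ⟨F₀, u, p, V, hF₀pos, min_le_right _ _, ?_, ?_, ?_, hV0⟩
    · exact hu.mono hF₀pos (min_le_left _ _)
    · exact hV.mono le_rfl hF₀pos.le (min_le_left _ _)
    · exact fun t _ => hsyn t
  /- the induction -/
  have hiter : ∀ k : ℕ, ∃ (F : ℝ) (u : ℝ → EuclideanSpace ℝ (Fin 3) → EuclideanSpace ℝ (Fin 3))
      (p : ℝ → EuclideanSpace ℝ (Fin 3) → ℝ) (V : ℝ → EuclideanSpace ℝ (Fin 3) → Fin 3 → ℂ),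
      0 < F ∧ F ≤ Tw ∧ State F u p V ∧ (Tt ≤ F ∨ (k : ℝ) * (TP / 2) ≤ F) := by
    intro k
    induction k with
    | zero =>
      obtain ⟨F, u, p, V, hF, hFw, hS⟩ := hbase
      exact ⟨F, u, p, V, hF, hFw, hS, Or.inr (by simpa using hF.le)⟩
    | succ k ih =>
      obtain ⟨F, u, p, V, hF, hFw, hS, halt⟩ := ih
      rcases le_or_gt Tt F with hdone | hlt
      · exact ⟨F, u, p, V, hF, hFw, hS, Or.inl hdone⟩
      · obtain ⟨F', u', p', V', hprog, hF'w, hF'pos, hS'⟩ := hstep hF hlt.le hS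
        refine ⟨F', u', p', V', hF'pos, hF'w, hS', ?_⟩
        rcases hprog with hTw' | hadv
        · exact Or.inl (hTtw.le.trans hTw')
        · rcases halt with hd | hk
          · exact absurd hd (not_le.2 hlt)
          · right
            push_cast
            linarith
  obtain ⟨k, hk⟩ := exists_nat_gt (Tw / (TP / 2))
  obtain ⟨F, u, p, V, hF, hFw, hS, halt⟩ := hiter k
  have hTtF : Tt ≤ F := by
    rcases halt with hd | hk'
    · exact hd
    · exfalso
      have h2 : Tw < (k : ℝ) * (TP / 2) := by rwa [div_lt_iff₀ (by positivity)] at hk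
      linarith
  exact ⟨u, p, hS.1.mono hTt hTtF⟩

/-! ### Weak = strong: the energy solution is the Kato solution below the Kato lifespan -/

section Agreement

variable {ν : ℝ} {a : EuclideanSpace ℝ (Fin 3) → EuclideanSpace ℝ (Fin 3)}
  {v : ℝ → EuclideanSpace ℝ (Fin 3) → EuclideanSpace ℝ (Fin 3)}

/-- **Weak = strong below the Kato lifespan** ("This solution is smooth and unique for
sufficiently small values of `t`", Seregin 2012, p. 2; Prodi 1959 / Serrin 1963, Thm. 6 =
Robinson–Rodrigo–Sadowski 2016, Thm. 8.19; Lemarié-Rieusset 2016, Prop. 12.3 with Thm. 7.7).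
Let `ν > 0`, `a` smooth, compactly supported and divergence free, `v` a global Leray–Hopf (energy)
solution from `a`, and `w` a Kato solution on `[0, T')` from `a`. Then `v(t) = w(t)` a.e. for every
`t ∈ (0, T')`. Proof: for `t < S < T'` the Tao-class solution `u` on `[0, S]`
(`exists_isTaoSolutionOn_of_isKatoSolutionOn`) is a Leray–Hopf solution from `a`
(`IsTaoSolutionOn.isLerayHopfOn`) and is bounded on `[0, S] × ℝ³`
(`IsTaoSolutionOn.exists_bound_velocity`), i.e. lies in Serrin's class `L^∞(0,S; L^∞)`
(`memLqLp_top_top_of_bound`), so `v(t) = u(t)` a.e. by the proved weak–strong uniqueness theorem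
(`weak_strong_uniqueness_holds`); and `u(t) = w(t)` a.e. by uniqueness in `C([0,S); L³)`
(`IsTaoSolutionOn.ae_eq_of_kato`, i.e. `kato_unique_holds`). [cite: Prodi1959] [cite: LemarieRieusset2016, Prop. 12.3 with Thm. 7.7] -/
theorem IsGlobalLerayHopf.ae_eq_of_isKatoSolutionOn (hν : 0 < ν) (ha : ContDiff ℝ ∞ a)
    (hac : HasCompactSupport a) (hdiv : VectorCalculus.IsDivFree a) (hv : IsGlobalLerayHopf ν 0 a v)
    {T' : ℝ} {w : ℝ → EuclideanSpace ℝ (Fin 3) → EuclideanSpace ℝ (Fin 3)}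
    (hw : IsKatoSolutionOn T' ν a w) : ∀ t ∈ Ioo 0 T', v t =ᵐ[volume] w t := by
  intro t ht
  -- an intermediate closed slab `[0, S]`, `t < S < T'`
  set S : ℝ := (t + T') / 2 with hS
  have htS : t < S := by rw [hS]; linarith [ht.2]
  have hST' : S < T' := by rw [hS]; linarith [ht.2]
  have hS0 : 0 < S := ht.1.trans htS
  -- the Tao-class solution from `a` on `[0, S]`
  have hdiv' : NSWave0.IsDivFree a := hdiv
  obtain ⟨u, p, hu⟩ := exists_isTaoSolutionOn_of_isKatoSolutionOn hν ha hdiv'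
    (HasRapidSpatialDecay.of_hasCompactSupport ha hac) hw hS0 hST'
  -- it is Leray–Hopf from `a` and in Serrin's class `L^∞_t L^∞_x`
  have hLH : IsLerayHopfOn S ν 0 a u := hu.isLerayHopfOn hS0
  obtain ⟨B, -, hB⟩ := hu.exists_bound_velocity
  have hSer : MemLqLp ∞ ∞ u (Ioo 0 S) :=
    memLqLp_top_top_of_bound (fun s hs => hu.aestronglyMeasurable_slice hs) hB
  -- weak–strong uniqueness: `v = u`
  have h1 : v t =ᵐ[volume] u t :=
    weak_strong_uniqueness_holds hν hS0 hLH (q := ∞) (r := ∞) ENNReal.ofNat_lt_top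
      (by simp [ENNReal.div_top]) hSer (hv.isLerayHopfOn hS0) t ⟨ht.1, htS.le⟩
  -- uniqueness in `C([0,S); L³)`: `u = w`
  have h2 : u t =ᵐ[volume] w t :=
    hu.ae_eq_of_kato hν (hw.mild.mono (Ico_subset_Ico_right hST'.le))
      (hw.continuousInLpOn.mono (Ico_subset_Ico_right hST'.le))
      (hw.aestronglyMeasurable.mono_measure (Measure.restrict_mono
        (Set.prod_mono (Ioo_subset_Ioo_right hST'.le) Subset.rfl) le_rfl)) t ⟨ht.1.le, htS⟩
  exact h1.trans h2

/-- **Space–time form of the agreement**: under the hypotheses of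
`IsGlobalLerayHopf.ae_eq_of_isKatoSolutionOn`, `v = w` a.e. on the strip `(0, T') × ℝ³`
(Fubini upgrade `ae_restrict_prod_of_forall_ae_eq`; both fields are measurable on the strip, `v`
as a weak solution on `[0, T')`, `w` as a Kato solution). [folklore] -/
theorem IsGlobalLerayHopf.ae_eq_uncurry_of_isKatoSolutionOn (hν : 0 < ν) (ha : ContDiff ℝ ∞ a)
    (hac : HasCompactSupport a) (hdiv : VectorCalculus.IsDivFree a) (hv : IsGlobalLerayHopf ν 0 a v)
    {T' : ℝ} (hT' : 0 < T') {w : ℝ → EuclideanSpace ℝ (Fin 3) → EuclideanSpace ℝ (Fin 3)}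
    (hw : IsKatoSolutionOn T' ν a w) :
    uncurry v =ᵐ[volume.restrict (Ioo 0 T' ×ˢ univ)] uncurry w :=
  ae_restrict_prod_of_forall_ae_eq (hv.ae_eq_of_isKatoSolutionOn hν ha hac hdiv hw)
    (hv.isLerayHopfOn hT').weak.1 hw.aestronglyMeasurable

end Agreement

/-! ### The assembly: Seregin's Thm. 1.1 from Thm. 15.1 (C) and the core of Thm. 15.5 -/

/-- **Seregin 2012, Thm. 1.1 (energy solutions, as printed) from the two leaves of
Lemarié-Rieusset's Thm. 15.5** — `lemarieRieusset_singular_point_of_blowup` (Lemarié-Rieusset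
2016, Thm. 15.1 (C): a finite maximal time of the mild `C_t L³` solution carries a singular point)
and `seregin_regular_of_liminf_L3` (the core of the proof of Thm. 15.5, PDF pp. 570–573 =
Seregin 2012, §§2–4: an `L³` bound along `t_k ↑ T` makes every `(T, x₀)` regular). Let `v` be an
energy solution from `a ∈ C^∞_{0,0}` with finite blow-up time `T` (no singular point in
`(0, T) × ℝ³`, a singular point `(T, x₀)`), and let `T_max = katoMaximalTime ν a > 0`
(`katoMaximalTime_pos`, `kato_local_holds`). (i) `T ≤ T_max`: otherwise the maximal Kato solution
`u` on `[0, T_max)` (`exists_isKatoSolutionOn_katoMaximalTime`, `kato_unique_holds`; maximality by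
`not_isKatoSolutionOn_of_katoMaximalTime_lt`) has a singular point `(T_max, x₁)` by Thm. 15.1 (C),
and since `v = u` a.e. on `(0, T_max) × ℝ³` (`IsGlobalLerayHopf.ae_eq_uncurry_of_isKatoSolutionOn`)
so has `v` (`eLpNorm_parabolicCylinder_eq_top_of_ae_eq`) — at the time `T_max ∈ (0, T)`, where
every point is regular. (ii) Hence a Kato solution `u` of `a` lives on `[0, T)`, and
`‖v(t)‖₃ = ‖u(t)‖₃` for `0 < t < T`. If `‖v(t)‖₃ ↛ ∞` as `t ↑ T`, some level `M` is undershot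
frequently (`ENNReal.tendsto_nhds_top_iff_nnreal`), i.e. `liminf_{t↑T} ‖u(t)‖₃ < ∞`, so `u` is
essentially bounded on some `Q_r(T, x₀)` (`seregin_regular_of_liminf_L3`), hence so is `v` —
contradicting the singular point `(T, x₀)`. Seregin's §2, first paragraph, with the
identification of the energy solution with the mild solution made explicit. [cite: Seregin2012CMP, Thm. 1.1 and §2] [cite: LemarieRieusset2016, Thm. 15.1 (C) and Thm. 15.5 (proof, pp. 570–573)] -/
theorem seregin_L3_blowup_energy_of_leaves (h1 : lemarieRieusset_singular_point_of_blowup)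
    (h2 : seregin_regular_of_liminf_L3) : seregin_L3_blowup_energy := by
  intro ν T hν hT a v ha hac hdiv hv hreg hsing
  obtain ⟨x₀, hx₀⟩ := hsing
  -- the datum: `L³`, weakly divergence free
  have ha3 : MemLp a 3 volume := ha.continuous.memLp_of_hasCompactSupport hac
  have hwdiv : IsWeaklyDivFree a :=
    VectorCalculus.IsDivFree.isWeaklyDivFree_holds hdiv (ha.of_le (mod_cast le_top))
  -- the Kato maximal time of `a`
  have hTm0 : 0 < katoMaximalTime ν a := katoMaximalTime_pos kato_local_holds hν ha3 hwdiv
  -- (i) `T ≤ T_max`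
  have hTle : ENNReal.ofReal T ≤ katoMaximalTime ν a := by
    by_contra hlt
    rw [not_le] at hlt
    have htop : katoMaximalTime ν a < ⊤ := lt_of_lt_of_le hlt le_top
    obtain ⟨u, hu⟩ := exists_isKatoSolutionOn_katoMaximalTime kato_unique_holds hν hTm0 htop
    set Tr : ℝ := (katoMaximalTime ν a).toReal with hTr_def
    have hTr0 : 0 < Tr := ENNReal.toReal_pos hTm0.ne' htop.ne
    have hofReal : ENNReal.ofReal Tr = katoMaximalTime ν a := ENNReal.ofReal_toReal htop.ne
    have hTrT : Tr < T := by
      rw [← hofReal] at hlt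
      exact (ENNReal.ofReal_lt_ofReal_iff hT).1 hlt
    -- maximality of `T_max` in the Kato form
    have hmax : ∀ T'' : ℝ, Tr < T'' →
        ∀ w : ℝ → EuclideanSpace ℝ (Fin 3) → EuclideanSpace ℝ (Fin 3),
          ¬ IsKatoSolutionOn T'' ν a w :=
      fun T'' hT'' w => not_isKatoSolutionOn_of_katoMaximalTime_lt (by
        rw [← hofReal]
        exact (ENNReal.ofReal_lt_ofReal_iff (hTr0.trans hT'')).2 hT'')
    -- the singular point of the maximal Kato solution at `T_max` …
    obtain ⟨x₁, hx₁⟩ := h1 hν hTr0 ha3 hwdiv hu hmax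
    have hall : ∀ r : ℝ, 0 < r →
        eLpNorm (uncurry u) (⊤ : ℝ≥0∞) (volume.restrict (parabolicCylinder r ((Tr : ℝ), x₁))) = ⊤ :=
      fun r hr => eLpNorm_top_parabolicCylinder_eq_top_of_small hTr0 hx₁ hr
    -- … is a singular point of `v` at the time `T_max ∈ (0, T)`: excluded
    have hae : uncurry v =ᵐ[volume.restrict (Ioo 0 Tr ×ˢ univ)] uncurry u :=
      hv.ae_eq_uncurry_of_isKatoSolutionOn hν ha hac hdiv hTr0 hu
    obtain ⟨r, hr, hfin⟩ := hreg ((Tr : ℝ), x₁) ⟨hTr0, hTrT⟩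
    exact hfin.ne (eLpNorm_parabolicCylinder_eq_top_of_ae_eq hTr0 hae x₁ hall hr)
  -- (ii) the Kato solution of `a` on `[0, T)`
  obtain ⟨u, hu⟩ : ∃ u, IsKatoSolutionOn T ν a u := by
    rcases hTle.lt_or_eq with hlt | heq
    · exact exists_isKatoSolutionOn_of_ofReal_lt_katoMaximalTime hlt
    · have htop : katoMaximalTime ν a < ⊤ := by rw [← heq]; exact ENNReal.ofReal_lt_top
      obtain ⟨u, hu⟩ := exists_isKatoSolutionOn_katoMaximalTime kato_unique_holds hν hTm0 htop
      refine ⟨u, ?_⟩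
      rwa [← heq, ENNReal.toReal_ofReal hT.le] at hu
  have hae : uncurry v =ᵐ[volume.restrict (Ioo 0 T ×ˢ univ)] uncurry u :=
    hv.ae_eq_uncurry_of_isKatoSolutionOn hν ha hac hdiv hT hu
  -- if `‖v(t)‖₃ ↛ ∞`, some level `M` is undershot frequently …
  rw [ENNReal.tendsto_nhds_top_iff_nnreal]
  by_contra hnot
  obtain ⟨M, hM⟩ := not_forall.1 hnot
  have hfreq : ∃ᶠ t in 𝓝[<] T, eLpNorm (v t) 3 volume ≤ M :=
    (not_eventually.1 hM).mono fun t ht => not_lt.1 ht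
  -- … by `u` as well (`v(t) = u(t)` a.e. for `0 < t < T`) …
  have hfreq' : ∃ᶠ t in 𝓝[<] T, eLpNorm (u t) 3 volume ≤ M := by
    refine (hfreq.and_eventually (Ioo_mem_nhdsLT hT)).mono fun t ht => ?_
    rw [← eLpNorm_congr_ae (hv.ae_eq_of_isKatoSolutionOn hν ha hac hdiv hu t ht.2)]
    exact ht.1
  -- … so `(T, x₀)` is regular for `u`, hence for `v`: contradiction
  obtain ⟨r, hr, hfin⟩ := h2 hν hT ha3 hwdiv hu ⟨M, hfreq'⟩ x₀
  exact hfin.ne (eLpNorm_parabolicCylinder_eq_top_of_ae_eq hT hae.symm x₀ hx₀ hr)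

/-- The same reduction in dependency-tracker form (facts conjoined): once
`lemarieRieusset_singular_point_of_blowup` and `seregin_regular_of_liminf_L3` are discharged,
`seregin_L3_blowup_energy_holds` follows. [cite: Seregin2012CMP, Thm. 1.1] -/
theorem seregin_L3_blowup_energy_of_and
    (h : lemarieRieusset_singular_point_of_blowup ∧ seregin_regular_of_liminf_L3) :
    seregin_L3_blowup_energy :=
  seregin_L3_blowup_energy_of_leaves h.1 h.2

end Literature.Analysis.FluidPDE

end
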